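import Literature.AlgebraicGeometry.Deformation.VectorBundleLifting
import HarnessLib

/-!
# Obstruction theory for lifting vector bundles across first-order thickenings, on real carriers

Layer `Literature/AlgebraicGeometry/Deformation`; the notion requested by
`defn-VectorBundleExtensionObstruction` (consumer: crux `HadicSemiregularLiftR`,
route HodgeConjecture/AmpleAdicLefschetz — clauses (i) FINITE WINDOW, (S) window-semiregular
representatives, and mechanism (M), which reads `ob_m ∈ H²(Y, 𝓔nd E₀ ⊗ N^{-m})`). It is the
VECTOR-BUNDLE specialisation of `SquareZeroExtensionObstruction` in which every posited carrier is
replaced by a real one (sibling `VectorBundleLifting`): perfect complexes ↦ `𝒪`-modules that are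
vector bundles (`Motives.IsVectorBundle`), `Li^*` ↦ `Scheme.Modules.pullback`, the posited
`Ext n K I` ↦ `obstructionGroup n E I = Extⁿ_{𝒪_Z}(E, E ⊗ I)` (Mathlib `Abelian.Ext`, tensor product
of `Modules/TensorProduct`), the posited `Lifts i K₀` ↦ the quotient type `LiftClass i E₀`, and
"a lift exists" ↦ the proposition `LiftsAlong i E₀`. Consequently no junk instance can decide
`LiftsAlong`: an instance with `ob := 0` must PROVE that every vector bundle lifts across every
first-order thickening (refuter CRUX-ATTACK-2686 §7(3)).

Sources read, verbatim (locators as in `VectorBundleLifting`): The Stacks Project Tag 08VR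
(Lemma 6.1; here with `(S ⊂ S') = (X ⊂ X')`, `f = id`, `F` finite locally free): "(1) There exists
an `𝒪_{X'}`-module `F'` flat over `S'` with `i^*F' ≅ F`, if and only if the class
`o(F, f^*𝒥 ⊗_{𝒪_X} F, 1) ∈ Ext²_{𝒪_X}(F, f^*𝒥 ⊗_{𝒪_X} F)` of Lemma 4.4 is zero. (2) If such a module
exists, then the set of isomorphism classes of lifts is principal homogeneous under
`Ext¹_{𝒪_X}(F, f^*𝒥 ⊗_{𝒪_X} F)`"; Tag 08L7 (Lemma 4.3: the extensions `0 → K → F' → F → 0` with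
given `c_{F'}` are "principal homogeneous under `Ext¹_{𝒪_X}(F, K)`" — the action: add an
`𝒪_X`-extension); Tag 08LK, proof: "`Ext¹_{𝒪_{X'}}(F', 𝓘G') = Ext¹_{𝒪_X}(Li^*F', 𝓘G')` the
adjointness of `i_* = Ri_*` and `Li^*` on the derived category". Huybrechts–Thomas (2010)
Cor. 3.4: "There is a deformation `E` of `E₀` if and only if
`0 = (id_{E₀} ⊗ κ(X₀/X)) ∘ A(E₀) ∈ Ext²_{X₀}(E₀, E₀ ⊗ I)`, in which case the deformations form a
torsor over `Ext¹_{X₀}(E₀, E₀ ⊗ I)`" (perfect `E₀`; for `E₀` locally free the derived restriction and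
tensor are the plain ones). Lieblich (2006) Thm. 3.1.1 (obstruction `ω(E₀) ∈ Ext²`, pseudo-torsor
under `Ext¹`) and Cor. 3.1.2: "Suppose `J ⊇ I` annihilates `I`, and let `Ā = A/J`, `Ē = E₀ ⊗ᴸ Ā`.
There is an element `ω(E₀) ∈ Ext²_{X_Ā}(Ē, Ē ⊗ᴸ_Ā I)` which vanishes if and only if there is a
deformation of `E₀` to `X_A`. The set of deformations … is a pseudo-torsor under
`Ext¹_{X_Ā}(Ē, Ē ⊗ᴸ_Ā I)`" ("immediate consequence of the cher à Cartan isomorphisms").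
Česnavičius (2020) §2: "there is no obstruction to deforming `𝒱` to `U_{R₂}` (see [Ill05, 8.5.3 (b)])
… The obstruction to deforming `𝒱₂` to `U_{R₃}` is again controlled by `H²(U_R, 𝓔nd(𝒱))` …
Proceeding in this way, we lift `𝒱` to a vector bundle `𝒱̂ := lim_n 𝒱_n` on the formal `f`-adic
completion." Classical attributions: SGA 1 III, Illusie IV §3, Illusie FGA Explained 8.5.3,
Hartshorne *Deformation Theory* Thm. 7.1.

## Content

* `VectorBundleExtensionObstruction` — HYPOTHESIS STRUCTURE (D-0014/D-0019) with exactly the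
  printed properties as fields, all between REAL objects: `ob i E₀ h ∈ Ext²(E₀, E₀ ⊗ 𝓘)` for a
  vector bundle `E₀` (`h : IsVectorBundle E₀`) and a first-order thickening `i` with ideal
  `𝓘 = conormalSheaf i`; `ob = 0 ↔ LiftsAlong i E₀` (08VR (1), HT Cor. 3.4); the action `act` of
  `Ext¹(E₀, E₀ ⊗ 𝓘)` on `LiftClass i E₀`, free and transitive (08VR (2), 08L7); the adjunction
  isomorphism `extRestrict : Extⁿ_Z(E, E ⊗ j_*I) ≃+ Extⁿ_Y(j^*E, j^*E ⊗ I)` for `j` a closed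
  immersion and `E` a vector bundle (Lieblich Cor. 3.1.2; 08LK). Consumers take `V` as a
  PARAMETER; the intended instance (`o(F, 𝓘 ⊗ F, 1)`: Tag 08L8, push-out along an injective
  envelope; equivalently the Čech cocycle of local trivialisations, or truncated Atiyah ∘
  Kodaira–Spencer) is a construction the tree lacks; NO existence fact
  `Nonempty VectorBundleExtensionObstruction` is vendored (D-0026).
* PROVED from the fields: `ob_eq_zero_iff_nonempty`, `liftsAlong_of_subsingleton` (`Ext² = 0 ⇒`
  lift), `liftsAlong_of_isIso` (trivial thickening), `act_injective`, `liftClassEquiv` and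
  `liftClassAddTorsor` (a lift trivialises the torsor; Mathlib `AddTorsor` over the `AddAction`
  `V.addAction`), `subsingleton_liftClass` / `exists_iso_of_subsingleton` (`Ext¹ = 0 ⇒` unique lift);
  over a closed subscheme `j : Y ⟶ Z₀` with `𝓘 ≅ j_*I` and `j^*E ≅ E₀`: `groupOnBase`
  (`Extⁿ_{Z₀}(E, E ⊗ 𝓘) ≃+ Extⁿ_Y(E₀, E₀ ⊗ I)`), `obOnBase` (the class `ob_m` READ IN
  `Ext²_Y(E₀, E₀ ⊗ I)` — the source of the twisted semiregularity map of the consumer's (M)),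
  `obOnBase_eq_zero_iff`, `liftsAlong_of_subsingleton_base`, `subsingleton_liftClass_base`; along
  the `Y`-adic tower `T` of a closed immersion `f : Y ⟶ X` with coefficient family `L m` and
  identifications `e m : conormalSheaf (T.transition m) ≅ (T.incl f m)_* (L m)` (intended
  `L m = N^{-(m+1)}`): `liftsAlong_transition_of_subsingleton` / `subsingleton_liftClass_transition`
  (one step beyond the window), `liftsAlong_incl_zero` (base), `liftsFormally_of_forall_subsingleton`
  (EMPTY WINDOW ⇒ `LiftsFormally`, Česnavičius §2 / Ravindra–Tripathi), and
  `exists_system_above_of_window` (FINITE WINDOW ⇒ a bundle on `Y_k` restricting to `E₀` extends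
  to all `Y_{k+n}`: finite determinacy, existence half).

Not here (deliberately): naturality of `ob` along morphisms of thickenings and in `E₀` (needs
pull-back maps on `Ext` along non-exact functors and the monoidality of `Scheme.Modules.pullback`,
neither in Mathlib; no consumer clause uses it); the automorphism statement 08VR (3)
(`Aut(F'/F) = Ext⁰`); the CONSTRUCTION of the intended instance; the twisted semiregularity map
`σ^{(m)}` on `obstructionGroup 2 E₀ (L m)` (separate request `defn-TwistedSemiregularityMap`);
the finite-window EXISTENCE theorem (Serre duality/vanishing; the route's support item); the
uniqueness half of finite determinacy as one statement (it is `subsingleton_liftClass_transition`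
levelwise).

## References

* [StacksProject] Tags 08KY, 08L7, 08L8, 08LK, 08LM, 08VR.  * [HuybrechtsThomas2010] §3.1, Cor. 3.4.
* [Lieblich2006] Thm. 3.1.1, Cor. 3.1.2, Def. 3.2.1.  * [Cesnavicius2020GLVectorBundles] §1–§2.
* [RavindraTripathi2013Extensions] §1.  * [Illusie1971] IV §3, [SGA1] III (attribution only).
-/

noncomputable section

open CategoryTheory CategoryTheory.Limits AlgebraicGeometry

universe u

namespace Literature.AlgebraicGeometry.Deformation

open Literature.AlgebraicGeometry.FormalGeometry Literature.AlgebraicGeometry.Motives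
  Literature.AlgebraicGeometry.Modules

/-! ### (b) The hypothesis structure: obstruction theory for vector bundles, on real carriers -/

/-- **Obstruction theory for lifting vector bundles across first-order thickenings** — the
vector-bundle specialisation of `SquareZeroExtensionObstruction` in which the posited carrier
of perfect complexes is REPLACED by real `𝒪`-modules that are vector bundles
(`Motives.IsVectorBundle`), the derived pull-back by Mathlib's `Scheme.Modules.pullback`, the
posited `Ext`-groups by the real `obstructionGroup n E I = Extⁿ_{𝒪_Z}(E, E ⊗ I)`, and the posited
type of lifts by the real `LiftClass i E₀`; so that "`E₀` lifts" (`LiftsAlong`, real) cannot be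
made true or false by a junk instance. Fields = exactly the printed statements, for a
first-order thickening `i : Z₀ ⟶ Z₁` of schemes with ideal `𝓘` (as `𝒪_{Z₀}`-module:
`conormalSheaf i`) and a vector bundle `E₀` on `Z₀` (Tag 08VR with `(S ⊂ S') = (X ⊂ X')`,
`f = id`, `F` finite locally free hence flat; the flat lifts `F'` are then exactly the finite
locally free ones): (1) an obstruction `ob i E₀ ∈ Ext²_{𝒪_{Z₀}}(E₀, E₀ ⊗ 𝓘)` which is zero iff a
lift exists ("There exists an `𝒪_{X'}`-module `F'` flat over `S'` with `i^*F' ≅ F`, if and only if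
the class `o(F, f^*J ⊗_{𝒪_X} F, 1) ∈ Ext²_{𝒪_X}(F, f^*J ⊗_{𝒪_X} F)` is zero"; Huybrechts–Thomas
Cor. 3.4: "There is a deformation `E` of `E₀` if and only if `0 = … ∈ Ext²_{X₀}(E₀, E₀ ⊗ I)`");
(2) a free and transitive action of `Ext¹_{𝒪_{Z₀}}(E₀, E₀ ⊗ 𝓘)` on the isomorphism classes of
lifts ("If such a module exists, then the set of isomorphism classes of lifts is principal
homogeneous under `Ext¹_{𝒪_X}(F, f^*J ⊗_{𝒪_X} F)`"; "in which case the deformations form a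
torsor over `Ext¹_{X₀}(E₀, E₀ ⊗ I)`"); (3) the adjunction ("cher à Cartan") isomorphism
`Extⁿ_Z(E, E ⊗ j_*I) ≅ Extⁿ_Y(j^*E, j^*E ⊗ I)` along a closed immersion `j : Y ⟶ Z` for `E`
locally free (`E ⊗ j_*I = j_*(j^*E ⊗ I)` and `Extⁿ_{𝒪_Z}(F, j_*G) = Extⁿ_{𝒪_Y}(Lj^*F, G)` with
`Lj^*E = j^*E`; Lieblich Cor. 3.1.2, Tag 08LK (proof)), by which the groups of a thickening
`Y_m ⊂ Y_{m+1}` whose ideal is killed by the ideal of `Y ⊂ Y_m` are computed on `Y`.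
Consumers take `(V : VectorBundleExtensionObstruction)` as a PARAMETER; the intended instance
(`o(F, 𝓘 ⊗ F, 1)` of Tag 08L8: push-out along an injective envelope; equivalently the Čech
2-cocycle of local trivialisations, or the truncated Atiyah class composed with the
Kodaira–Spencer class) is a construction the tree does not have, and no existence fact
`Nonempty VectorBundleExtensionObstruction` is vendored (D-0026).
[cite: StacksProject, Tag 08VR] [cite: HuybrechtsThomas2010, Cor. 3.4]
[cite: Lieblich2006, Thm. 3.1.1 and Cor. 3.1.2] -/
structure VectorBundleExtensionObstruction where
  /-- The **obstruction class** `ob i E₀ ∈ Ext²_{𝒪_{Z₀}}(E₀, E₀ ⊗ 𝓘)` of a vector bundle `E₀` on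
  `Z₀` with respect to the first-order thickening `i : Z₀ ⟶ Z₁` with ideal `𝓘 = conormalSheaf i`
  (`o(F, 𝓘 ⊗ F, 1)`; `ϖ(E₀) = (id ⊗ κ(X₀/X)) ∘ A(E₀)`).
  [cite: StacksProject, Tag 08VR] [cite: HuybrechtsThomas2010, Cor. 3.4] -/
  ob : ∀ {Z₀ Z₁ : Scheme.{u}} (i : Z₀ ⟶ Z₁) [IsFirstOrderThickening i] (E₀ : Z₀.Modules),
    IsVectorBundle E₀ → obstructionGroup 2 E₀ (conormalSheaf i)
  /-- "There exists `F'` flat over `X'` with `i^*F' ≅ F` if and only if the class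
  `o(F, 𝓘 ⊗ F, 1) ∈ Ext²` is zero" / "There is a deformation `E` of `E₀` if and only if `0 = ϖ(E₀)`".
  [cite: StacksProject, Tag 08VR] [cite: HuybrechtsThomas2010, Cor. 3.4] -/
  ob_eq_zero_iff : ∀ {Z₀ Z₁ : Scheme.{u}} (i : Z₀ ⟶ Z₁) [IsFirstOrderThickening i]
    (E₀ : Z₀.Modules) (h : IsVectorBundle E₀), ob i E₀ h = 0 ↔ LiftsAlong i E₀
  /-- The **action** `act i E₀ x ℓ = x · ℓ` of `Ext¹_{𝒪_{Z₀}}(E₀, E₀ ⊗ 𝓘)` on the isomorphism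
  classes of lifts (add the `𝒪_{Z₀}`-extension `x` to the `𝒪_{Z₁}`-extension
  `0 → 𝓘 ⊗ F → F' → F → 0`, Tag 08L7). An explicit map rather than an `AddAction` instance,
  because the carriers `obstructionGroup`, `LiftClass` are real types not mentioning the theory
  `V`. For `E₀` not a vector bundle `LiftClass i E₀` is empty and `act` is the empty action.
  [cite: StacksProject, Tags 08L7 and 08VR] -/
  act : ∀ {Z₀ Z₁ : Scheme.{u}} (i : Z₀ ⟶ Z₁) [IsFirstOrderThickening i] (E₀ : Z₀.Modules),
    obstructionGroup 1 E₀ (conormalSheaf i) → LiftClass i E₀ → LiftClass i E₀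
  /-- `0 · ℓ = ℓ`. [cite: StacksProject, Tag 08L7] -/
  zero_act : ∀ {Z₀ Z₁ : Scheme.{u}} (i : Z₀ ⟶ Z₁) [IsFirstOrderThickening i] (E₀ : Z₀.Modules)
    (ℓ : LiftClass i E₀), act i E₀ 0 ℓ = ℓ
  /-- `(x + y) · ℓ = x · (y · ℓ)` (Baer sum of extensions). [cite: StacksProject, Tag 08L7] -/
  add_act : ∀ {Z₀ Z₁ : Scheme.{u}} (i : Z₀ ⟶ Z₁) [IsFirstOrderThickening i] (E₀ : Z₀.Modules)
    (x y : obstructionGroup 1 E₀ (conormalSheaf i)) (ℓ : LiftClass i E₀),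
    act i E₀ (x + y) ℓ = act i E₀ x (act i E₀ y ℓ)
  /-- The action is **free** ("principal homogeneous"). [cite: StacksProject, Tag 08VR] -/
  eq_zero_of_act_eq : ∀ {Z₀ Z₁ : Scheme.{u}} (i : Z₀ ⟶ Z₁) [IsFirstOrderThickening i]
    (E₀ : Z₀.Modules) (x : obstructionGroup 1 E₀ (conormalSheaf i)) (ℓ : LiftClass i E₀),
    act i E₀ x ℓ = ℓ → x = 0
  /-- The action is **transitive** ("If such a module exists, then the set of isomorphism classes
  of lifts is principal homogeneous under `Ext¹`"; "the deformations form a torsor over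
  `Ext¹_{X₀}(E₀, E₀ ⊗ I)`"). [cite: StacksProject, Tag 08VR] [cite: HuybrechtsThomas2010, Cor. 3.4] -/
  exists_act_eq : ∀ {Z₀ Z₁ : Scheme.{u}} (i : Z₀ ⟶ Z₁) [IsFirstOrderThickening i]
    (E₀ : Z₀.Modules) (ℓ ℓ' : LiftClass i E₀), ∃ x : obstructionGroup 1 E₀ (conormalSheaf i),
    act i E₀ x ℓ = ℓ'
  /-- **Adjunction isomorphism** along a closed immersion `j : Y ⟶ Z`, for a vector bundle `E`
  on `Z` and an `𝒪_Y`-module `I`: `Extⁿ_Z(E, E ⊗ j_*I) ≅ Extⁿ_Y(j^*E, j^*E ⊗ I)` (projection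
  formula `E ⊗ j_*I = j_*(j^*E ⊗ I)` for `E` locally free, and the adjunction
  `Extⁿ_{𝒪_Z}(F, j_*G) = Extⁿ_{𝒪_Y}(Lj^*F, G)` — "the adjointness of `i_* = Ri_*` and `Li^*` on the
  derived category" — with `Lj^*E = j^*E` for `E` locally free; Lieblich's "cher à Cartan
  isomorphisms"). [cite: Lieblich2006, Cor. 3.1.2] [cite: StacksProject, Tag 08LK (proof)] -/
  extRestrict : ∀ (n : ℕ) {Y Z : Scheme.{u}} (j : Y ⟶ Z) [IsClosedImmersion j] (E : Z.Modules),
    IsVectorBundle E → ∀ I : Y.Modules,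
      obstructionGroup n E ((Scheme.Modules.pushforward j).obj I) ≃+
        obstructionGroup n ((Scheme.Modules.pullback j).obj E) I

namespace VectorBundleExtensionObstruction

variable (V : VectorBundleExtensionObstruction.{u})

include V

section Lifting

variable {Z₀ Z₁ : Scheme.{u}} (i : Z₀ ⟶ Z₁) [IsFirstOrderThickening i] (E₀ : Z₀.Modules)

/-- **Tag 08VR (1) in terms of classes**: `ob i E₀ = 0 ↔` the set of isomorphism classes of lifts is
non-empty. [cite: StacksProject, Tag 08VR] -/
theorem ob_eq_zero_iff_nonempty (h : IsVectorBundle E₀) :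
    V.ob i E₀ h = 0 ↔ Nonempty (LiftClass i E₀) :=
  (V.ob_eq_zero_iff i E₀ h).trans (liftsAlong_iff_nonempty_liftClass i E₀)

/-- **Unobstructedness by vanishing of `Ext²`**: if `Ext²_{𝒪_{Z₀}}(E₀, E₀ ⊗ 𝓘) = 0` then the vector
bundle `E₀` lifts across `i` ("there is no obstruction to deforming `𝒱` to `U_{R₂}` (see
[Ill05, 8.5.3 (b)])"). [cite: StacksProject, Tag 08VR]
[cite: Cesnavicius2020GLVectorBundles, §2 (proof of the main lifting step)] -/
theorem liftsAlong_of_subsingleton (h : IsVectorBundle E₀)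
    [Subsingleton (obstructionGroup 2 E₀ (conormalSheaf i))] : LiftsAlong i E₀ :=
  (V.ob_eq_zero_iff i E₀ h).mp (Subsingleton.elim _ _)

/-- A vector bundle lifts along an ISOMORPHISM (a trivial first-order thickening: `𝓘 = 0`, so
`Ext²(E₀, E₀ ⊗ 𝓘) = 0`). [cite: StacksProject, Tags 08KY and 08VR] -/
theorem liftsAlong_of_isIso [IsIso i] (h : IsVectorBundle E₀) : LiftsAlong i E₀ :=
  haveI := subsingleton_obstructionGroup_of_isZero 2 E₀ _ (isZero_conormalSheaf_of_isIso i)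
  V.liftsAlong_of_subsingleton i E₀ h

/-- The action of `Ext¹_{𝒪_{Z₀}}(E₀, E₀ ⊗ 𝓘)` on the classes of lifts as a Mathlib `AddAction` (a
`def`, to be introduced locally with `letI` by consumers who want the `+ᵥ` notation).
[cite: StacksProject, Tag 08VR] -/
@[reducible]
def addAction : AddAction (obstructionGroup 1 E₀ (conormalSheaf i)) (LiftClass i E₀) where
  vadd := V.act i E₀
  zero_vadd := V.zero_act i E₀
  add_vadd := V.add_act i E₀

/-- Freeness: `x ↦ x · ℓ` is injective for every class of lifts `ℓ`. [cite: StacksProject, Tag 08VR] -/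
theorem act_injective (ℓ : LiftClass i E₀) :
    Function.Injective fun x : obstructionGroup 1 E₀ (conormalSheaf i) => V.act i E₀ x ℓ := by
  intro x y hxy
  have h' : V.act i E₀ (-y + x) ℓ = ℓ := by
    dsimp only at hxy
    rw [V.add_act, hxy, ← V.add_act, neg_add_cancel, V.zero_act]
  exact (neg_add_eq_zero.mp (V.eq_zero_of_act_eq i E₀ (-y + x) ℓ h')).symm

/-- **A lift trivialises the torsor**: `x ↦ x · ℓ` is a bijection
`Ext¹_{𝒪_{Z₀}}(E₀, E₀ ⊗ 𝓘) ≃ LiftClass i E₀` ("principal homogeneous").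
[cite: StacksProject, Tag 08VR] [cite: HuybrechtsThomas2010, Cor. 3.4] -/
def liftClassEquiv (ℓ : LiftClass i E₀) : obstructionGroup 1 E₀ (conormalSheaf i) ≃ LiftClass i E₀ :=
  Equiv.ofBijective (fun x => V.act i E₀ x ℓ)
    ⟨V.act_injective i E₀ ℓ, fun ℓ' => V.exists_act_eq i E₀ ℓ ℓ'⟩

/-- `liftClassEquiv ℓ x = x · ℓ`. [cite: StacksProject, Tag 08VR] -/
@[simp]
theorem liftClassEquiv_apply (ℓ : LiftClass i E₀) (x : obstructionGroup 1 E₀ (conormalSheaf i)) :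
    V.liftClassEquiv i E₀ ℓ x = V.act i E₀ x ℓ :=
  rfl

/-- When a lift exists, the isomorphism classes of lifts form a **torsor** (Mathlib `AddTorsor`,
over the `AddAction` `V.addAction i E₀`) under `Ext¹_{𝒪_{Z₀}}(E₀, E₀ ⊗ 𝓘)`.
[cite: StacksProject, Tag 08VR] [cite: HuybrechtsThomas2010, Cor. 3.4] -/
@[reducible]
def liftClassAddTorsor [Nonempty (LiftClass i E₀)] :
    letI := V.addAction i E₀
    AddTorsor (obstructionGroup 1 E₀ (conormalSheaf i)) (LiftClass i E₀) :=
  letI := V.addAction i E₀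
  { vsub := fun ℓ ℓ' => Classical.choose (V.exists_act_eq i E₀ ℓ' ℓ)
    vsub_vadd' := fun ℓ ℓ' => Classical.choose_spec (V.exists_act_eq i E₀ ℓ' ℓ)
    vadd_vsub' := fun x ℓ =>
      V.act_injective i E₀ ℓ (Classical.choose_spec (V.exists_act_eq i E₀ ℓ (V.act i E₀ x ℓ))) }

/-- **Rigidity by vanishing of `Ext¹`**: if `Ext¹_{𝒪_{Z₀}}(E₀, E₀ ⊗ 𝓘) = 0` there is at most one
isomorphism class of lifts. [cite: StacksProject, Tag 08VR] -/
theorem subsingleton_liftClass [Subsingleton (obstructionGroup 1 E₀ (conormalSheaf i))] :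
    Subsingleton (LiftClass i E₀) := by
  refine ⟨fun ℓ ℓ' => ?_⟩
  obtain ⟨x, rfl⟩ := V.exists_act_eq i E₀ ℓ ℓ'
  rw [Subsingleton.elim x 0, V.zero_act]

/-- If `Ext¹_{𝒪_{Z₀}}(E₀, E₀ ⊗ 𝓘) = 0`, any two lifts `(E₁, α)`, `(E₁', α')` of `E₀` are isomorphic
compatibly with `α`, `α'` (uniqueness of lifts beyond an obstruction window).
[cite: StacksProject, Tag 08VR] -/
theorem exists_iso_of_subsingleton [Subsingleton (obstructionGroup 1 E₀ (conormalSheaf i))]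
    (ℓ ℓ' : Lift i E₀) :
    ∃ e : ℓ.obj ≅ ℓ'.obj, (Scheme.Modules.pullback i).map e.hom ≫ ℓ'.iso.hom = ℓ.iso.hom :=
  haveI := V.subsingleton_liftClass i E₀
  LiftClass.exact (Subsingleton.elim _ _)

end Lifting

/-! ### The obstruction computed on a closed subscheme (Lieblich Cor. 3.1.2 for bundles) -/

section Over

variable {Y Z₀ Z₁ : Scheme.{u}} (j : Y ⟶ Z₀) [IsClosedImmersion j] (i : Z₀ ⟶ Z₁)
  [IsFirstOrderThickening i] (E : Z₀.Modules) {E₀ : Y.Modules}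

/-- **The obstruction groups of `i` read on `Y`.** If the ideal `𝓘` of the first-order thickening
`i : Z₀ ⟶ Z₁` is, as an `𝒪_{Z₀}`-module, `j_*I` for an `𝒪_Y`-module `I` along a closed immersion
`j : Y ⟶ Z₀` (`𝓘` is killed by the ideal of `Y`; the `Y`-adic situation `Y ⊂ Y_m ⊂ Y_{m+1}` with
`I = 𝓘^{m+1}/𝓘^{m+2}`), and `j^*E ≅ E₀` for a vector bundle `E` on `Z₀`, then
`Extⁿ_{Z₀}(E, E ⊗ 𝓘) ≃+ Extⁿ_Y(E₀, E₀ ⊗ I)` (`extRestrict` and transport).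
[cite: Lieblich2006, Cor. 3.1.2] -/
def groupOnBase (hE : IsVectorBundle E) (α : (Scheme.Modules.pullback j).obj E ≅ E₀)
    (I : Y.Modules) (e : conormalSheaf i ≅ (Scheme.Modules.pushforward j).obj I) (n : ℕ) :
    obstructionGroup n E (conormalSheaf i) ≃+ obstructionGroup n E₀ I :=
  ((obstructionGroupMapIso n E e).trans (V.extRestrict n j E hE I)).trans
    (obstructionGroupCongr n α I)

/-- **The obstruction class of `E` across `i`, read in `Ext²_Y(E₀, E₀ ⊗ I)`** — the element
`ob_m ∈ H²(Y, 𝓔nd E₀ ⊗ 𝓘^{m+1}/𝓘^{m+2})` of the `Y`-adic lifting problem.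
[cite: Lieblich2006, Cor. 3.1.2] [cite: StacksProject, Tag 08VR] -/
def obOnBase (hE : IsVectorBundle E) (α : (Scheme.Modules.pullback j).obj E ≅ E₀)
    (I : Y.Modules) (e : conormalSheaf i ≅ (Scheme.Modules.pushforward j).obj I) :
    obstructionGroup 2 E₀ I :=
  V.groupOnBase j i E hE α I e 2 (V.ob i E hE)

/-- **Lieblich Cor. 3.1.2 (bundles), obstruction half**: `obOnBase = 0 ↔ E` lifts across `i`.
[cite: Lieblich2006, Cor. 3.1.2] [cite: StacksProject, Tag 08VR] -/
theorem obOnBase_eq_zero_iff (hE : IsVectorBundle E) (α : (Scheme.Modules.pullback j).obj E ≅ E₀)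
    (I : Y.Modules) (e : conormalSheaf i ≅ (Scheme.Modules.pushforward j).obj I) :
    V.obOnBase j i E hE α I e = 0 ↔ LiftsAlong i E := by
  rw [obOnBase, map_eq_zero_iff _ (AddEquiv.injective _), V.ob_eq_zero_iff]

/-- **Unobstructedness from the base**: if `Ext²_Y(E₀, E₀ ⊗ I) = 0` then `E` lifts across `i`
(the finite-window mechanism: `H²(Y, 𝓔nd E₀ ⊗ N^{-m}) = 0` for `m ≫ 0`).
[cite: Lieblich2006, Cor. 3.1.2] [cite: Cesnavicius2020GLVectorBundles, §2 (proof of the main lifting step)] -/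
theorem liftsAlong_of_subsingleton_base (hE : IsVectorBundle E)
    (α : (Scheme.Modules.pullback j).obj E ≅ E₀) (I : Y.Modules)
    (e : conormalSheaf i ≅ (Scheme.Modules.pushforward j).obj I)
    [Subsingleton (obstructionGroup 2 E₀ I)] : LiftsAlong i E :=
  (V.obOnBase_eq_zero_iff j i E hE α I e).mp (Subsingleton.elim _ _)

/-- **Rigidity from the base**: if `Ext¹_Y(E₀, E₀ ⊗ I) = 0` there is at most one isomorphism class
of lifts of `E` across `i`. [cite: Lieblich2006, Cor. 3.1.2] [cite: StacksProject, Tag 08VR] -/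
theorem subsingleton_liftClass_base (hE : IsVectorBundle E)
    (α : (Scheme.Modules.pullback j).obj E ≅ E₀) (I : Y.Modules)
    (e : conormalSheaf i ≅ (Scheme.Modules.pushforward j).obj I)
    [Subsingleton (obstructionGroup 1 E₀ I)] : Subsingleton (LiftClass i E) :=
  haveI : Subsingleton (obstructionGroup 1 E (conormalSheaf i)) :=
    (V.groupOnBase j i E hE α I e 1).toEquiv.subsingleton
  V.subsingleton_liftClass i E

end Over

end VectorBundleExtensionObstruction

/-! ### (c) Along the `Y`-adic tower: steps beyond the window, formal lifts -/

section Tower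

variable {Y X : Scheme.{u}} (f : Y ⟶ X) (T : FormalNeighbourhoodTower f.ker)

namespace VectorBundleExtensionObstruction

variable (V : VectorBundleExtensionObstruction.{u}) {f T} {E₀ : Y.Modules}

include V

/-- **One step up the tower beyond the window (existence)**: a vector bundle `E` on `Y_m`
restricting to `E₀` on `Y` lifts across `Y_m ⟶ Y_{m+1}` as soon as `Ext²_Y(E₀, E₀ ⊗ L m) = 0`,
where `L m` is the ideal of `Y_m` in `Y_{m+1}` read on `Y` ("The obstruction to deforming `𝒱₂` to
`U_{R₃}` is again controlled by `H²(U_R, 𝓔nd(𝒱))`, so `𝒱₂` lifts").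
[cite: Cesnavicius2020GLVectorBundles, §2 (proof of the main lifting step)] [cite: Lieblich2006, Cor. 3.1.2] -/
theorem liftsAlong_transition_of_subsingleton [IsClosedImmersion f] (L : ℕ → Y.Modules)
    (e : ∀ m, conormalSheaf (T.transition m) ≅ (Scheme.Modules.pushforward (T.incl f m)).obj (L m))
    (m : ℕ) (E : (T.obj m).Modules) (hE : IsVectorBundle E)
    (α : (Scheme.Modules.pullback (T.incl f m)).obj E ≅ E₀)
    [Subsingleton (obstructionGroup 2 E₀ (L m))] : LiftsAlong (T.transition m) E :=
  V.liftsAlong_of_subsingleton_base (T.incl f m) (T.transition m) E hE α (L m) (e m)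

/-- **One step up the tower beyond the window (uniqueness)**: if `Ext¹_Y(E₀, E₀ ⊗ L m) = 0` a vector
bundle on `Y_m` restricting to `E₀` has at most one isomorphism class of lifts to `Y_{m+1}`.
[cite: StacksProject, Tag 08VR] [cite: Lieblich2006, Cor. 3.1.2] -/
theorem subsingleton_liftClass_transition [IsClosedImmersion f] (L : ℕ → Y.Modules)
    (e : ∀ m, conormalSheaf (T.transition m) ≅ (Scheme.Modules.pushforward (T.incl f m)).obj (L m))
    (m : ℕ) (E : (T.obj m).Modules) (hE : IsVectorBundle E)
    (α : (Scheme.Modules.pullback (T.incl f m)).obj E ≅ E₀)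
    [Subsingleton (obstructionGroup 1 E₀ (L m))] : Subsingleton (LiftClass (T.transition m) E) :=
  V.subsingleton_liftClass_base (T.incl f m) (T.transition m) E hE α (L m) (e m)

/-- **The base of the tower**: a vector bundle `E₀` on `Y` lifts along `Y ⟶ Y_0` (an isomorphism for a
closed immersion `f`, `FormalNeighbourhoodTower.isIso_base`). [cite: StacksProject, Tags 08KY and 08VR] -/
theorem liftsAlong_incl_zero [IsClosedImmersion f] (h : IsVectorBundle E₀) :
    LiftsAlong (T.incl f 0) E₀ :=
  (V.liftsAlong_of_isIso (T.base f) E₀ h).of_eq (T.incl_zero f).symm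

/-- **Empty window ⇒ formal lift** (the case `H²(Y, 𝓔nd E₀ ⊗ N^{-m}) = 0` for ALL `m ≥ 1` of
Ravindra–Tripathi / Česnavičius; Grothendieck's argument for `Pic`): a vector bundle `E₀` on `Y`
all of whose window groups `Ext²_Y(E₀, E₀ ⊗ L m)` vanish lifts to a compatible system of vector
bundles on all the infinitesimal neighbourhoods `Y_m` ("Proceeding in this way, we lift `𝒱` to a
vector bundle `𝒱̂ := lim_n 𝒱_n` on the formal completion").
[cite: Cesnavicius2020GLVectorBundles, §2 (proof of the main lifting step)]
[cite: RavindraTripathi2013Extensions, §1] -/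
theorem liftsFormally_of_forall_subsingleton [IsClosedImmersion f] (L : ℕ → Y.Modules)
    (e : ∀ m, conormalSheaf (T.transition m) ≅ (Scheme.Modules.pushforward (T.incl f m)).obj (L m))
    (h : IsVectorBundle E₀) (hL : ∀ m, Subsingleton (obstructionGroup 2 E₀ (L m))) :
    LiftsFormally f T E₀ :=
  liftsFormally_of_forall_liftsAlong (V.liftsAlong_incl_zero h) fun m E hE hα =>
    hα.elim fun α => V.liftsAlong_transition_of_subsingleton L e m E hE α

/-- **Finite window ⇒ finite determinacy** (existence half): if the window groups `Ext²_Y(E₀, E₀ ⊗ L m)`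
vanish for `m ≥ k`, every vector bundle `E_k` on `Y_k` restricting to `E₀` extends to a compatible
system of vector bundles `E_{k+n}` on all higher neighbourhoods `Y_{k+n}` ("a bundle on `Y_{m₀}`
extends to a formal vector bundle": only `ob_1, …, ob_{m₀}` can obstruct).
[cite: Cesnavicius2020GLVectorBundles, §2 (proof of the main lifting step)] [cite: Lieblich2006, Cor. 3.1.2] -/
theorem exists_system_above_of_window [IsClosedImmersion f] (L : ℕ → Y.Modules)
    (e : ∀ m, conormalSheaf (T.transition m) ≅ (Scheme.Modules.pushforward (T.incl f m)).obj (L m))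
    (k : ℕ) (hL : ∀ m, k ≤ m → Subsingleton (obstructionGroup 2 E₀ (L m)))
    (Ek : (T.obj k).Modules) (hEk : IsVectorBundle Ek)
    (αk : (Scheme.Modules.pullback (T.incl f k)).obj Ek ≅ E₀) :
    ∃ E : (n : ℕ) → (T.obj (k + n)).Modules, (∀ n, IsVectorBundle (E n)) ∧ E 0 = Ek ∧
      (∀ n, Nonempty ((Scheme.Modules.pullback (T.incl f (k + n))).obj (E n) ≅ E₀)) ∧
      ∀ n, Nonempty ((Scheme.Modules.pullback (T.transition (k + n))).obj (E (n + 1)) ≅ E n) := by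
  classical
  let Stage : ℕ → Type (u + 1) := fun n =>
    { E : (T.obj (k + n)).Modules // IsVectorBundle E ∧
        Nonempty ((Scheme.Modules.pullback (T.incl f (k + n))).obj E ≅ E₀) }
  let base : Stage 0 := ⟨Ek, hEk, ⟨αk⟩⟩
  have step : ∀ (n : ℕ) (s : Stage n), { s' : Stage (n + 1) //
      Nonempty ((Scheme.Modules.pullback (T.transition (k + n))).obj s'.1 ≅ s.1) } := by
    intro n s
    let α := s.2.2.some
    haveI := hL (k + n) (Nat.le_add_right k n)
    have hl : LiftsAlong (T.transition (k + n)) s.1 :=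
      V.liftsAlong_transition_of_subsingleton L e (k + n) s.1 s.2.1 α
    let E' : (T.obj (k + n + 1)).Modules := Classical.choose hl
    have hE' := Classical.choose_spec hl
    let t := hE'.2.some
    exact ⟨⟨E', hE'.1, ⟨pullbackInclIso (Nat.le_succ (k + n)) E' ≪≫
      (Scheme.Modules.pullback (T.incl f (k + n))).mapIso t ≪≫ α⟩⟩, ⟨t⟩⟩
  let stages : ∀ n, Stage n := fun n => Nat.rec base (fun n s => (step n s).1) n
  refine ⟨fun n => (stages n).1, fun n => (stages n).2.1, rfl, fun n => (stages n).2.2, fun n => ?_⟩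
  exact (step n (stages n)).2

end VectorBundleExtensionObstruction

end Tower

end Literature.AlgebraicGeometry.Deformation

end
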